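import Summits.Ventures.HodgeRepro2.T5SU11KernelUniformBounds
import Summits.Ventures.HodgeRepro2.T5SU11KernelCompositionSharpDisc

/-!
# The Taylor series of the composed kernels converges uniformly in `(t, s)` away from the corner

Row 591 gave, on the sharp disc `|μ − μ₂| < (λ₂ − 1)²`, the pointwise Taylor series
`K_λ^{∘(n+1)}(t, s) = Σ_k (μ − μ₂)^k C(n+k, k) K_{λ₂}^{∘(n+k+1)}(t, s)`. Row 602's uniform bound
`|K_{λ₂}^{∘(n+k+1)}(t, s)| ≤ C Ξ(s) Ξ(t)/((λ₂ − 1)²)^{n+k}` on `{max(t, s) ≥ a}` dominates the `k`-th term by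
`C/((λ₂ − 1)²)ⁿ · C(k+n, n) q^k`, `q = |μ − μ₂|/(λ₂ − 1)² < 1`, whose sum is `C (1 − q)^{−n−1}/((λ₂ − 1)²)ⁿ`
(Mathlib's `summable_choose_mul_geometric_of_norm_lt_one`); the Weierstrass M-test (`tendstoUniformlyOn_tsum_nat`) gives:

* `kernel_comp_taylor_term_le` — the `k`-th term bound, uniform in `(t, s)` on `{max(t, s) ≥ a}`;
* `tendstoUniformlyOn_kernel_comp_taylor` — **on the sharp disc the partial sums of the Taylor series of `K^{∘(n+1)}` converge
  to `K_λ^{∘(n+1)}` uniformly in `(t, s)` on `{t, s > 0, max(t, s) ≥ a}`**, for every `n` and `a > 0`;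
* `tendstoUniformlyOn_kernel_comp_taylor'` — the same on `(0, ∞) × [a, ∞)`.

The corner `t, s → 0` is excluded for the reason proved in row 603. Nothing is claimed about (N).

Blind lane: Mathlib + the HodgeRepro2 prefix only; no sorry; axioms ⊆ {propext, Classical.choice,
Quot.sound}.
-/

namespace Summit.Ventures.HodgeRepro2.T5SU11KernelCompositionTaylorUniform

open Filter Topology MeasureTheory
open Set (Ioi Ioc)
open T5SU11Cartan T5SU11SphericalFunction T5SU11SphericalBounds T5SU11SphericalDecay T5SU11RadialGreenKernel
  T5SU11RadialGreenImproper T5SU11KernelUniformBounds T5SU11KernelCompositionSharpDisc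

section measure

variable [MeasurableSpace Circle] [BorelSpace Circle]

variable {lam lam₂ : ℝ} (hlam : 1 < lam) (hlam₂ : 1 < lam₂)

include hlam₂ in
/-- **The `k`-th Taylor term of the composed kernel, uniformly in `(t, s)` on `{max(t, s) ≥ a}`**:
`|(μ − μ₂)^k C(n+k, k) K_{λ₂}^{∘(n+k+1)}(t, s)| ≤ C/((λ₂ − 1)²)ⁿ · C(k+n, n) (|μ − μ₂|/(λ₂ − 1)²)^k`. -/
theorem kernel_comp_taylor_term_le {a : ℝ} (ha : 0 < a) (n : ℕ) :
    ∃ C : ℝ, 0 < C ∧ ∀ k : ℕ, ∀ t s, 0 < t → 0 < s → a ≤ max t s →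
      |(lam * (lam - 2) - lam₂ * (lam₂ - 2)) ^ k * (((n + k).choose k : ℝ)
          * ((greenSolI (fun t => sph lam₂ (hyp t)) (sphDecay lam₂))^[n + k] (fun r => sphGreenKernel lam₂ r s)) t)|
        ≤ C / ((lam₂ - 1) ^ 2) ^ n
          * (((k + n).choose n : ℝ) * (|lam * (lam - 2) - lam₂ * (lam₂ - 2)| / (lam₂ - 1) ^ 2) ^ k) := by
  obtain ⟨C, hC, hC'⟩ := exists_kernel_comp_le_uniform_of_le_max hlam₂ ha
  refine ⟨C, hC, fun k t s ht hs hm => ?_⟩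
  have hr : 0 < (lam₂ - 1) ^ 2 := by
    have : 0 < lam₂ - 1 := by linarith
    positivity
  have hb := hC' (n + k) t s ht hs hm
  have hΞt : sph 1 (hyp t) ≤ 1 := sph_hyp_le_one zero_le_one one_le_two t
  have hΞs : sph 1 (hyp s) ≤ 1 := sph_hyp_le_one zero_le_one one_le_two s
  have hΞt0 : 0 < sph 1 (hyp t) := sph_hyp_pos 1 t
  have hch : (n + k).choose k = (k + n).choose n := by
    rw [add_comm n k, Nat.choose_symm_add]
  have hchpos : (0 : ℝ) ≤ ((n + k).choose k : ℝ) := Nat.cast_nonneg _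
  rw [abs_mul, abs_mul, abs_pow, abs_of_nonneg hchpos]
  calc |lam * (lam - 2) - lam₂ * (lam₂ - 2)| ^ k * (((n + k).choose k : ℝ)
        * |((greenSolI (fun t => sph lam₂ (hyp t)) (sphDecay lam₂))^[n + k] (fun r => sphGreenKernel lam₂ r s)) t|)
      ≤ |lam * (lam - 2) - lam₂ * (lam₂ - 2)| ^ k * (((n + k).choose k : ℝ)
        * (C * sph 1 (hyp s) * sph 1 (hyp t) / ((lam₂ - 1) ^ 2) ^ (n + k))) := by
        apply mul_le_mul_of_nonneg_left _ (pow_nonneg (abs_nonneg _) k)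
        exact mul_le_mul_of_nonneg_left hb hchpos
    _ ≤ |lam * (lam - 2) - lam₂ * (lam₂ - 2)| ^ k * (((n + k).choose k : ℝ)
        * (C * 1 * 1 / ((lam₂ - 1) ^ 2) ^ (n + k))) := by
        apply mul_le_mul_of_nonneg_left _ (pow_nonneg (abs_nonneg _) k)
        apply mul_le_mul_of_nonneg_left _ hchpos
        apply div_le_div_of_nonneg_right _ (pow_nonneg hr.le _)
        exact mul_le_mul (mul_le_mul_of_nonneg_left hΞs hC.le) hΞt hΞt0.le (by positivity)
    _ = C / ((lam₂ - 1) ^ 2) ^ n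
          * (((k + n).choose n : ℝ) * (|lam * (lam - 2) - lam₂ * (lam₂ - 2)| / (lam₂ - 1) ^ 2) ^ k) := by
        rw [hch, pow_add, div_pow]
        field_simp

include hlam hlam₂ in
/-- **THE TAYLOR SERIES OF THE COMPOSED KERNELS CONVERGES UNIFORMLY AWAY FROM THE CORNER**: for `|μ − μ₂| < (λ₂ − 1)²` and every
`n`, the partial sums `Σ_{k<N} (μ − μ₂)^k C(n+k, k) K_{λ₂}^{∘(n+k+1)}(t, s)` converge to `K_λ^{∘(n+1)}(t, s)` uniformly in `(t, s)`
on `{t, s > 0, max(t, s) ≥ a}` (Weierstrass M-test). -/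
theorem tendstoUniformlyOn_kernel_comp_taylor {a : ℝ} (ha : 0 < a)
    (hq : |lam * (lam - 2) - lam₂ * (lam₂ - 2)| < (lam₂ - 1) ^ 2) (n : ℕ) :
    TendstoUniformlyOn
      (fun N (p : ℝ × ℝ) => ∑ k ∈ Finset.range N, (lam * (lam - 2) - lam₂ * (lam₂ - 2)) ^ k * (((n + k).choose k : ℝ)
        * ((greenSolI (fun t => sph lam₂ (hyp t)) (sphDecay lam₂))^[n + k] (fun r => sphGreenKernel lam₂ r p.2)) p.1))
      (fun p => ((greenSolI (fun t => sph lam (hyp t)) (sphDecay lam))^[n] (fun r => sphGreenKernel lam r p.2)) p.1)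
      atTop {p : ℝ × ℝ | 0 < p.1 ∧ 0 < p.2 ∧ a ≤ max p.1 p.2} := by
  obtain ⟨C, _, hC'⟩ := kernel_comp_taylor_term_le (lam := lam) hlam₂ ha n
  have hr : 0 < (lam₂ - 1) ^ 2 := by
    have : 0 < lam₂ - 1 := by linarith
    positivity
  have hq0 : 0 ≤ |lam * (lam - 2) - lam₂ * (lam₂ - 2)| / (lam₂ - 1) ^ 2 := div_nonneg (abs_nonneg _) hr.le
  have hq1 : |lam * (lam - 2) - lam₂ * (lam₂ - 2)| / (lam₂ - 1) ^ 2 < 1 := (div_lt_one hr).mpr hq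
  have hnorm : ‖|lam * (lam - 2) - lam₂ * (lam₂ - 2)| / (lam₂ - 1) ^ 2‖ < 1 := by
    rw [Real.norm_eq_abs, abs_of_nonneg hq0]
    exact hq1
  have hu : Summable (fun k : ℕ => C / ((lam₂ - 1) ^ 2) ^ n
      * (((k + n).choose n : ℝ) * (|lam * (lam - 2) - lam₂ * (lam₂ - 2)| / (lam₂ - 1) ^ 2) ^ k)) :=
    (summable_choose_mul_geometric_of_norm_lt_one n hnorm).mul_left _
  refine (tendstoUniformlyOn_tsum_nat hu ?_).congr_right ?_
  · rintro k ⟨t, s⟩ ⟨ht, hs, hm⟩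
    rw [Real.norm_eq_abs]
    exact hC' k t s ht hs hm
  · rintro ⟨t, s⟩ ⟨ht, hs, _⟩
    exact (kernel_comp_hasSum hlam₂ hs hlam hq n ht).tsum_eq

include hlam hlam₂ in
/-- The uniform convergence of the Taylor series of the composed kernels on `(0, ∞) × [a, ∞)`. -/
theorem tendstoUniformlyOn_kernel_comp_taylor' {a : ℝ} (ha : 0 < a)
    (hq : |lam * (lam - 2) - lam₂ * (lam₂ - 2)| < (lam₂ - 1) ^ 2) (n : ℕ) :
    TendstoUniformlyOn
      (fun N (p : ℝ × ℝ) => ∑ k ∈ Finset.range N, (lam * (lam - 2) - lam₂ * (lam₂ - 2)) ^ k * (((n + k).choose k : ℝ)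
        * ((greenSolI (fun t => sph lam₂ (hyp t)) (sphDecay lam₂))^[n + k] (fun r => sphGreenKernel lam₂ r p.2)) p.1))
      (fun p => ((greenSolI (fun t => sph lam (hyp t)) (sphDecay lam))^[n] (fun r => sphGreenKernel lam r p.2)) p.1)
      atTop {p : ℝ × ℝ | 0 < p.1 ∧ a ≤ p.2} :=
  (tendstoUniformlyOn_kernel_comp_taylor hlam hlam₂ ha hq n).mono
    (fun _ hp => ⟨hp.1, lt_of_lt_of_le ha hp.2, le_trans hp.2 (le_max_right _ _)⟩)

end measure

end Summit.Ventures.HodgeRepro2.T5SU11KernelCompositionTaylorUniform
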